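import Mathlib.Analysis.Convex.Topology
import Mathlib.Analysis.SpecialFunctions.Exp
import Mathlib.LinearAlgebra.Matrix.Symmetric
import Literature.MathematicalPhysics.QuantumFieldTheory.Balaban1983to89.T4ShellMeasure
import Literature.MathematicalPhysics.QuantumFieldTheory.BalabanImbrieJaffe1984to88.BIJ85AgmonDefect

/-!
# N21 (NE7c) · AGMON ABSORPTION for the block obstacle problem: Schur ∕ AM–GM, the competitor bound, the boundary
# remainder and the ℓ² Caccioppoli form (lens Card 87 ∕ ROW P⁗, first half)

R134 seat pub-ymgap-dag-n21-d (g8), node N21 = NE7c (single-run shell-weight bound, NOT PRINTED in [Bałaban 1983–89],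
NOT proved), lane K3⁷ `SpineGivenEndpointR13SepCoPH` (stmt-QuantumFields-20544, `--kind proof --supports … --as helper`).
Part 35 of the comparison series.  THIS FILE = §A (first half: `schur_amgm_symm` … `caccioppoli_l2_of_energy`) of the lens's `Sketch-nearmiss-g30.lean` (LENS-nearmiss v30.0 ROW P⁗, confirmed v31.0; first refusal dag-n21-d) — farm rc 0 · 0 warnings at
the lens desk — VERBATIM, statements and proofs, re-homed in this namespace (§A split in two files for the 400-line rule).
AUTHORSHIP OF THE MATHEMATICS: planner seat `ym-lens-BalabanUVNodes-nearmiss` g30 (memo-only seat, cannot file); this seat only files.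
The decay letters (`slow_of_depth`, ★ `agmon_decay_finiteRange`, ★ `agmon_decay_expEntries`) land as part 36
`…N21BoxObstacleAgmonDecayLetters` importing this file.

WHAT (lens Card 87).  Part 33's `weightedEnergy_le_comm` stops at `⟨ηe, A(ηe)⟩ ≤ ½ Σ|A_xy||e_x||e_y|(η_x − η_y)²`; one
ABSORPTION separates it from the core-reading letter: on pairs where the weight is slowly varying,
`(η_x − η_y)² ≤ ω_xy η_x η_y`, AM–GM and a weighted Schur row-sum bound `Σ_y |A_xy| ω_xy ≤ γ` swallow the interior into the
left side (`agmon_absorb`; `schur_amgm_symm`; `caccioppoli_l2_of_energy`); the remainder lives on pairs touching the zero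
set of `η` and is bounded by `H²Γ‖e‖₂²` (`agmonBoundary_le`, `agmonBoundary_le_kernel`); the energy is bounded by any feasible
competitor (`energy_le_of_competitor`, `quadForm_le_rowsum`).

HONEST FRAMING.  [textbook] finite sums ∕ linear algebra (cites the tree's `BIJ85AgmonDefect.sq_exp_sub_exp_le_of_abs_le`); 0 def, 0 sorry;
located letters (γ, Γ₁, Γ₂, α, w) are HYPOTHESES; nothing of Bałaban's asserted; NE7c NOT PRINTED ∕ NOT proved; N21 NOT
discharged; counts unmoved (typed 28∕28 · discharged 5∕27); count-neutral; one finite 𝕋⁴ at fixed ε — nothing about ℝ⁴ ∕ OS ∕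
mass gap ∕ Clay.
-/

open Set Matrix
open Literature.MathematicalPhysics.QuantumFieldTheory.BalabanImbrieJaffe1984to88 (BIJ85AgmonDefect.sq_exp_sub_exp_le_of_abs_le)
open Literature.MathematicalPhysics.QuantumFieldTheory.Balaban1983to89 (T4ShellMeasure.SlotAntiConcentration T4ShellMeasure.shell_eq_preimage)

namespace Summit.QuantumFields.YangMills.Theorems.N21BoxObstacleAgmonDecay

/-! ## §A  Card 87 — Agmon absorption and the pointwise decay letter -/
section Absorb

variable {κ : Type*} [Fintype κ]

/-- **AM–GM SCHUR BOUND.**  For a symmetric non-negative weight, `Σ_x Σ_y W_xy |a_x||a_y| ≤ Σ_x a_x² (Σ_y W_xy)`.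
[textbook: Schur test] -/
theorem schur_amgm_symm (W : κ → κ → ℝ) (hWs : ∀ x y, W x y = W y x) (hW0 : ∀ x y, 0 ≤ W x y) (a : κ → ℝ) :
    ∑ x, ∑ y, W x y * (|a x| * |a y|) ≤ ∑ x, a x ^ 2 * ∑ y, W x y := by
  have hpt : ∀ x y, W x y * (|a x| * |a y|) ≤ W x y * a x ^ 2 / 2 + W x y * a y ^ 2 / 2 := by
    intro x y
    have h := two_mul_le_add_sq (|a x|) (|a y|)
    rw [sq_abs, sq_abs] at h
    nlinarith [hW0 x y]
  have hswap : ∑ x, ∑ y, W x y * a y ^ 2 / 2 = ∑ x, ∑ y, W x y * a x ^ 2 / 2 := by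
    rw [Finset.sum_comm]
    refine Finset.sum_congr rfl fun x _ => Finset.sum_congr rfl fun y _ => ?_
    rw [hWs y x]
  calc ∑ x, ∑ y, W x y * (|a x| * |a y|)
      ≤ ∑ x, ∑ y, (W x y * a x ^ 2 / 2 + W x y * a y ^ 2 / 2) :=
        Finset.sum_le_sum fun x _ => Finset.sum_le_sum fun y _ => hpt x y
    _ = ∑ x, ∑ y, W x y * a x ^ 2 / 2 + ∑ x, ∑ y, W x y * a y ^ 2 / 2 := by
        simp only [Finset.sum_add_distrib]
    _ = ∑ x, ∑ y, W x y * a x ^ 2 := by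
        rw [hswap, ← Finset.sum_add_distrib]
        refine Finset.sum_congr rfl fun x _ => ?_
        rw [← Finset.sum_add_distrib]
        exact Finset.sum_congr rfl fun y _ => by ring
    _ = ∑ x, a x ^ 2 * ∑ y, W x y := by
        refine Finset.sum_congr rfl fun x _ => ?_
        rw [Finset.mul_sum]
        exact Finset.sum_congr rfl fun y _ => by ring

/-- **QUADRATIC FORM ≤ ROW-SUM × ℓ²-NORM².** `⟨v, Av⟩ ≤ Γ₁ Σ v_x²` when every row of `|A|` sums to `≤ Γ₁`. [textbook] -/
theorem quadForm_le_rowsum (A : Matrix κ κ ℝ) (hA : A.IsSymm) {Γ₁ : ℝ} (hΓ : ∀ x, ∑ y, |A x y| ≤ Γ₁)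
    (v : κ → ℝ) : v ⬝ᵥ (A *ᵥ v) ≤ Γ₁ * ∑ x, v x ^ 2 := by
  have h1 : v ⬝ᵥ (A *ᵥ v) ≤ ∑ x, ∑ y, |A x y| * (|v x| * |v y|) := by
    have : v ⬝ᵥ (A *ᵥ v) = ∑ x, ∑ y, A x y * (v x * v y) := by
      simp only [dotProduct, Matrix.mulVec, Finset.mul_sum]
      exact Finset.sum_congr rfl fun x _ => Finset.sum_congr rfl fun y _ => by ring
    rw [this]
    refine Finset.sum_le_sum fun x _ => Finset.sum_le_sum fun y _ => ?_
    rw [← abs_mul, ← abs_mul]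
    exact le_abs_self _
  have h2 := schur_amgm_symm (fun x y => |A x y|) (fun x y => by simp [hA.apply y x]) (fun _ _ => abs_nonneg _) v
  have h3 : ∑ x, v x ^ 2 * ∑ y, |A x y| ≤ ∑ x, v x ^ 2 * Γ₁ :=
    Finset.sum_le_sum fun x _ => mul_le_mul_of_nonneg_left (hΓ x) (sq_nonneg _)
  rw [← Finset.sum_mul] at h3
  linarith

/-- **ENERGY OF THE MINIMISER ≤ ENERGY OF ANY FEASIBLE COMPETITOR SUPPORTED ON THE VIOLATED SET.**  If `e` minimises
`⟨v,Av⟩` over the box and `v₀` is feasible with `|v₀| ≤ M` pointwise and `v₀ = 0` off `J`, then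
`γ‖e‖₂² ≤ ⟨e,Ae⟩ ≤ Γ₁ Σ_{x∈J} M_x²` (clipped linear centre: `J` = violated letters, `M` = overshoot). [textbook] -/
theorem energy_le_of_competitor (A : Matrix κ κ ℝ) (hA : A.IsSymm) {γ Γ₁ : ℝ}
    (hγ : ∀ a : κ → ℝ, γ * ∑ x, a x ^ 2 ≤ a ⬝ᵥ (A *ᵥ a)) (hΓ : ∀ x, ∑ y, |A x y| ≤ Γ₁)
    (lo hi e : κ → ℝ)
    (hmin : ∀ v : κ → ℝ, (∀ b, lo b ≤ v b ∧ v b ≤ hi b) → e ⬝ᵥ (A *ᵥ e) ≤ v ⬝ᵥ (A *ᵥ v))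
    (J : Finset κ) (M v₀ : κ → ℝ) (hv₀ : ∀ b, lo b ≤ v₀ b ∧ v₀ b ≤ hi b)
    (hv₀M : ∀ b, |v₀ b| ≤ M b) (hv₀J : ∀ b, b ∉ J → v₀ b = 0) :
    γ * ∑ x, e x ^ 2 ≤ Γ₁ * ∑ x ∈ J, M x ^ 2 := by
  have h1 := (hγ e).trans ((hmin v₀ hv₀).trans (quadForm_le_rowsum A hA hΓ v₀))
  rcases isEmpty_or_nonempty κ with hκ | ⟨⟨x₁⟩⟩
  · have hJ : J = ∅ := Finset.eq_empty_of_isEmpty J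
    simp [hJ]
  have hΓ0 : 0 ≤ Γ₁ := (Finset.sum_nonneg fun y _ => abs_nonneg (A x₁ y)).trans (hΓ x₁)
  have h2 : ∑ x, v₀ x ^ 2 ≤ ∑ x ∈ J, M x ^ 2 := by
    have hsplit : ∑ x, v₀ x ^ 2 = ∑ x ∈ J, v₀ x ^ 2 := by
      rw [← Finset.sum_subset (Finset.subset_univ J)]
      intro x _ hx
      simp [hv₀J x hx]
    rw [hsplit]
    refine Finset.sum_le_sum fun x _ => ?_
    have := hv₀M x
    rw [← sq_abs (v₀ x)]
    exact pow_le_pow_left₀ (abs_nonneg _) this 2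
  exact h1.trans (mul_le_mul_of_nonneg_left h2 hΓ0)

/-- **AGMON ABSORPTION.**  From the Caccioppoli inequality `γΣ(ηe)² ≤ ½Σ|A_xy||e_x||e_y|(η_x−η_y)²` (g29
`weightedEnergy_le_comm` + ℓ²-coercivity), a symmetric «interior» pair relation `R` on which the weight is slowly
varying, `(η_x − η_y)² ≤ ω_xy η_xη_y`, and the weighted Schur bound `Σ_y 1_R |A_xy| ω_xy ≤ γ`: the interior is absorbed
and `γΣ(ηe)² ≤ Σ_{¬R} |A_xy||e_x||e_y|(η_x−η_y)²`.  (`ω` constant = finite range; `ω_xy = (e^{α|x−y|} − 1)²` =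
exponentially decaying entries.) [textbook: Agmon ∕ Combes–Thomas] -/
theorem agmon_absorb (A : Matrix κ κ ℝ) (hA : A.IsSymm) {γ : ℝ} (e η : κ → ℝ)
    (hCacc : γ * ∑ x, (η x * e x) ^ 2
      ≤ 1 / 2 * ∑ x, ∑ y, |A x y| * (|e x| * |e y|) * (η x - η y) ^ 2)
    (R : κ → κ → Prop) [DecidableRel R] (hRs : ∀ x y, R x y → R y x)
    (ω : κ → κ → ℝ) (hωs : ∀ x y, ω x y = ω y x) (hω0 : ∀ x y, 0 ≤ ω x y)
    (hslow : ∀ x y, R x y → (η x - η y) ^ 2 ≤ ω x y * (η x * η y))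
    (hS : ∀ x, ∑ y, (if R x y then |A x y| * ω x y else 0) ≤ γ) :
    γ * ∑ x, (η x * e x) ^ 2
      ≤ ∑ x, ∑ y, (if R x y then 0 else |A x y| * (|e x| * |e y|) * (η x - η y) ^ 2) := by
  set c : κ → κ → ℝ := fun x y => if R x y then |A x y| * ω x y else 0 with hc
  set p : κ → ℝ := fun x => (η x * e x) ^ 2 / 2 with hp
  have hcsymm : ∀ x y, c y x = c x y := by
    intro x y
    simp only [hc]
    by_cases h : R x y
    · rw [if_pos h, if_pos (hRs x y h), hA.apply x y, hωs y x]
    · have h' : ¬ R y x := fun h'' => h (hRs y x h'')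
      rw [if_neg h, if_neg h']
  -- pointwise split of the commutator term
  have hpt : ∀ x y, |A x y| * (|e x| * |e y|) * (η x - η y) ^ 2
      ≤ (c x y * p x + c y x * p y)
        + (if R x y then 0 else |A x y| * (|e x| * |e y|) * (η x - η y) ^ 2) := by
    intro x y
    by_cases h : R x y
    · rw [if_pos h, hcsymm x y]
      simp only [hc, hp, if_pos h]
      have h1 := hslow x y h
      have h2 : η x * η y * (|e x| * |e y|) ≤ (η x * e x) ^ 2 / 2 + (η y * e y) ^ 2 / 2 := by
        have h := two_mul_le_add_sq (η x * |e x|) (η y * |e y|)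
        have hx : (η x * |e x|) ^ 2 = (η x * e x) ^ 2 := by rw [mul_pow, mul_pow, sq_abs]
        have hy : (η y * |e y|) ^ 2 = (η y * e y) ^ 2 := by rw [mul_pow, mul_pow, sq_abs]
        have he : η x * η y * (|e x| * |e y|) = (η x * |e x|) * (η y * |e y|) := by ring
        rw [hx, hy] at h
        rw [he]
        linarith
      have hee : 0 ≤ |e x| * |e y| := mul_nonneg (abs_nonneg _) (abs_nonneg _)
      have hA0 : 0 ≤ |A x y| := abs_nonneg _
      calc |A x y| * (|e x| * |e y|) * (η x - η y) ^ 2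
          ≤ |A x y| * (|e x| * |e y|) * (ω x y * (η x * η y)) :=
            mul_le_mul_of_nonneg_left h1 (mul_nonneg hA0 hee)
        _ = |A x y| * ω x y * (η x * η y * (|e x| * |e y|)) := by ring
        _ ≤ |A x y| * ω x y * ((η x * e x) ^ 2 / 2 + (η y * e y) ^ 2 / 2) :=
            mul_le_mul_of_nonneg_left h2 (mul_nonneg hA0 (hω0 x y))
        _ = |A x y| * ω x y * ((η x * e x) ^ 2 / 2) + |A x y| * ω x y * ((η y * e y) ^ 2 / 2) + 0 := by
            ring
    · rw [if_neg h]
      simp only [hc, hp, if_neg h]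
      have h' : ¬ R y x := fun h'' => h (hRs y x h'')
      rw [if_neg h']
      nlinarith [sq_nonneg (η x * e x), sq_nonneg (η y * e y)]
  -- sum it
  have hsum : ∑ x, ∑ y, |A x y| * (|e x| * |e y|) * (η x - η y) ^ 2
      ≤ ∑ x, ∑ y, (c x y * p x + c y x * p y)
        + ∑ x, ∑ y, (if R x y then 0 else |A x y| * (|e x| * |e y|) * (η x - η y) ^ 2) := by
    rw [← Finset.sum_add_distrib]
    refine Finset.sum_le_sum fun x _ => ?_
    rw [← Finset.sum_add_distrib]
    exact Finset.sum_le_sum fun y _ => hpt x y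
  -- the interior double sum is `2 Σ_x p_x C_x ≤ γ Σ (ηe)²`
  have hswap : ∑ x, ∑ y, c y x * p y = ∑ x, ∑ y, c x y * p x := by
    rw [Finset.sum_comm]
  have hint : ∑ x, ∑ y, (c x y * p x + c y x * p y) ≤ γ * ∑ x, (η x * e x) ^ 2 := by
    rw [Finset.sum_congr rfl fun x _ => Finset.sum_add_distrib, Finset.sum_add_distrib, hswap, ← two_mul]
    have hrow : ∀ x, ∑ y, c x y * p x ≤ γ * p x := by
      intro x
      rw [← Finset.sum_mul]
      exact mul_le_mul_of_nonneg_right (hS x) (by positivity)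
    calc 2 * ∑ x, ∑ y, c x y * p x ≤ 2 * ∑ x, γ * p x := by
          refine mul_le_mul_of_nonneg_left (Finset.sum_le_sum fun x _ => hrow x) (by norm_num)
      _ = γ * ∑ x, (η x * e x) ^ 2 := by
          rw [← Finset.mul_sum, Finset.mul_sum, Finset.mul_sum, Finset.mul_sum]
          refine Finset.sum_congr rfl fun x _ => ?_
          simp only [hp]
          ring
  linarith

/-- **THE BOUNDARY TERM.**  If off the interior relation every interacting pair has one end in the zero set of `η`
and the weight next to the zero set is at most `H`, then `Σ_{¬R}|A_xy||e_x||e_y|(η_x−η_y)² ≤ H²·Γ₁·‖e‖₂²`. [textbook] -/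
theorem agmonBoundary_le (A : Matrix κ κ ℝ) (hA : A.IsSymm) (e η : κ → ℝ) (R : κ → κ → Prop) [DecidableRel R]
    {H Γ₁ : ℝ}
    (hzero : ∀ x y, ¬ R x y → A x y ≠ 0 → η x = 0 ∨ η y = 0)
    (hH : ∀ x y, A x y ≠ 0 → η y = 0 → |η x| ≤ H)
    (hΓ : ∀ x, ∑ y, |A x y| ≤ Γ₁) :
    ∑ x, ∑ y, (if R x y then 0 else |A x y| * (|e x| * |e y|) * (η x - η y) ^ 2)
      ≤ H ^ 2 * Γ₁ * ∑ x, e x ^ 2 := by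
  have hpt : ∀ x y, (if R x y then 0 else |A x y| * (|e x| * |e y|) * (η x - η y) ^ 2)
      ≤ H ^ 2 * (|A x y| * (|e x| * |e y|)) := by
    intro x y
    have hnn : 0 ≤ |A x y| * (|e x| * |e y|) := by positivity
    by_cases h : R x y
    · rw [if_pos h]; positivity
    rw [if_neg h]
    by_cases hA0 : A x y = 0
    · simp [hA0]
    rcases hzero x y h hA0 with hx | hy
    · have hAyx : A y x ≠ 0 := (hA.apply x y).trans_ne hA0
      have hb := hH y x hAyx hx
      have hsq : (η x - η y) ^ 2 ≤ H ^ 2 := by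
        rw [hx, zero_sub, neg_sq, ← sq_abs]
        exact pow_le_pow_left₀ (abs_nonneg _) hb 2
      nlinarith
    · have hb := hH x y hA0 hy
      have hsq : (η x - η y) ^ 2 ≤ H ^ 2 := by
        rw [hy, sub_zero, ← sq_abs]
        exact pow_le_pow_left₀ (abs_nonneg _) hb 2
      nlinarith
  have h2 := schur_amgm_symm (fun x y => |A x y|) (fun x y => by simp [hA.apply y x]) (fun _ _ => abs_nonneg _) e
  have h3 : ∑ x, e x ^ 2 * ∑ y, |A x y| ≤ ∑ x, e x ^ 2 * Γ₁ :=
    Finset.sum_le_sum fun x _ => mul_le_mul_of_nonneg_left (hΓ x) (sq_nonneg _)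
  rw [← Finset.sum_mul] at h3
  calc ∑ x, ∑ y, (if R x y then 0 else |A x y| * (|e x| * |e y|) * (η x - η y) ^ 2)
      ≤ ∑ x, ∑ y, H ^ 2 * (|A x y| * (|e x| * |e y|)) :=
        Finset.sum_le_sum fun x _ => Finset.sum_le_sum fun y _ => hpt x y
    _ = H ^ 2 * ∑ x, ∑ y, |A x y| * (|e x| * |e y|) := by
        rw [Finset.mul_sum]
        exact Finset.sum_congr rfl fun x _ => by rw [Finset.mul_sum]
    _ ≤ H ^ 2 * (Γ₁ * ∑ x, e x ^ 2) := by
        refine mul_le_mul_of_nonneg_left ?_ (sq_nonneg _)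
        linarith
    _ = H ^ 2 * Γ₁ * ∑ x, e x ^ 2 := by ring

/-- **THE BOUNDARY TERM, KERNEL FORM (exponentially decaying entries).**  If off the interior relation
`|A_xy|(η_x − η_y)² ≤ H²·B_xy` for a symmetric non-negative kernel `B` with rows `≤ Γ₂` (for `η = e^{αρ}𝟙_{Zᶜ}`,
`B_xy = |A_xy|e^{2αℓ(x,y)}`, `H = e^{αw}`), then `Σ_{¬R}|A_xy||e_x||e_y|(η_x−η_y)² ≤ H²·Γ₂·‖e‖₂²`. [textbook] -/
theorem agmonBoundary_le_kernel (A : Matrix κ κ ℝ) (e η : κ → ℝ) (R : κ → κ → Prop) [DecidableRel R]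
    {H Γ₂ : ℝ} (B : κ → κ → ℝ) (hBs : ∀ x y, B x y = B y x) (hB0 : ∀ x y, 0 ≤ B x y)
    (hΓ : ∀ x, ∑ y, B x y ≤ Γ₂)
    (hdom : ∀ x y, ¬ R x y → |A x y| * (η x - η y) ^ 2 ≤ H ^ 2 * B x y) :
    ∑ x, ∑ y, (if R x y then 0 else |A x y| * (|e x| * |e y|) * (η x - η y) ^ 2)
      ≤ H ^ 2 * Γ₂ * ∑ x, e x ^ 2 := by
  have hpt : ∀ x y, (if R x y then 0 else |A x y| * (|e x| * |e y|) * (η x - η y) ^ 2)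
      ≤ H ^ 2 * (B x y * (|e x| * |e y|)) := by
    intro x y
    have hee : 0 ≤ |e x| * |e y| := by positivity
    by_cases h : R x y
    · rw [if_pos h]; exact mul_nonneg (sq_nonneg _) (mul_nonneg (hB0 x y) hee)
    rw [if_neg h]
    have := mul_le_mul_of_nonneg_right (hdom x y h) hee
    calc |A x y| * (|e x| * |e y|) * (η x - η y) ^ 2 = |A x y| * (η x - η y) ^ 2 * (|e x| * |e y|) := by ring
      _ ≤ H ^ 2 * B x y * (|e x| * |e y|) := this
      _ = H ^ 2 * (B x y * (|e x| * |e y|)) := by ring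
  have h2 := schur_amgm_symm B hBs hB0 e
  have h3 : ∑ x, e x ^ 2 * ∑ y, B x y ≤ ∑ x, e x ^ 2 * Γ₂ :=
    Finset.sum_le_sum fun x _ => mul_le_mul_of_nonneg_left (hΓ x) (sq_nonneg _)
  rw [← Finset.sum_mul] at h3
  calc ∑ x, ∑ y, (if R x y then 0 else |A x y| * (|e x| * |e y|) * (η x - η y) ^ 2)
      ≤ ∑ x, ∑ y, H ^ 2 * (B x y * (|e x| * |e y|)) :=
        Finset.sum_le_sum fun x _ => Finset.sum_le_sum fun y _ => hpt x y
    _ = H ^ 2 * ∑ x, ∑ y, B x y * (|e x| * |e y|) := by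
        rw [Finset.mul_sum]
        exact Finset.sum_congr rfl fun x _ => by rw [Finset.mul_sum]
    _ ≤ H ^ 2 * (Γ₂ * ∑ x, e x ^ 2) := by
        refine mul_le_mul_of_nonneg_left ?_ (sq_nonneg _)
        linarith
    _ = H ^ 2 * Γ₂ * ∑ x, e x ^ 2 := by ring

/-- **ℓ²-CACCIOPPOLI FROM THE ENERGY FORM.**  g29 `weightedEnergy_le_comm` bounds the weighted ENERGY
`⟨ηe, A(ηe)⟩`; the absorption needs the `ℓ²` left side, supplied by `ℓ²`-coercivity (NOT the sup-norm binder of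
g29 `weightedNorm_le_comm`, which is too weak to absorb). [bookkeeping] -/
theorem caccioppoli_l2_of_energy (A : Matrix κ κ ℝ) {γ : ℝ}
    (hγ : ∀ a : κ → ℝ, γ * ∑ x, a x ^ 2 ≤ a ⬝ᵥ (A *ᵥ a)) (e η : κ → ℝ) {rhs : ℝ}
    (hE : (η * e) ⬝ᵥ (A *ᵥ (η * e)) ≤ rhs) :
    γ * ∑ x, (η x * e x) ^ 2 ≤ rhs := by
  have h := (hγ (η * e)).trans hE
  simpa only [Pi.mul_apply] using h

end Absorb

end Summit.QuantumFields.YangMills.Theorems.N21BoxObstacleAgmonDecay
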